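import Summits.Ventures.CertifiedArithmetic.LowPrec.ErrorTables
import Summits.Ventures.CertifiedArithmetic.LowPrec.JRBridge

/-!
# Format conversions: embeddings of value sets, exact widening, commutativity across formats

HONEST FRAMING (venture CertifiedArithmetic / cell `pub-lowprec`): certified error envelopes and
provably optimal rounding/accumulation schemes for low-precision formats under stated cost models;
every table by two implementations; no hardware or vendor claims.

A conversion between formats is `roundNE ψ x.toRat` (round-to-nearest-even, saturating) applied to
the value of a datum `x : MiniFloat φ`; its error envelopes are those of `roundNE` (`Round.lean`,
`EnvelopeStructural.lean`) at `x.toRat`. This file proves the STRUCTURAL facts behind the cell's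
conversion and cross-format tables:

* EMBEDDING CRITERION (`MiniFloat.exists_toRat_eq_of_le`): if `ψ` has at least the precision of
  `φ` (`m_φ ≤ m_ψ`), a quantum at most that of `φ` (`qexp ψ ≤ qexp φ`) and at least its range
  (`maxRat φ ≤ maxRat ψ`), then every finite value of `φ` is a finite value of `ψ` — the value-set
  inclusion `F_φ ⊆ F_ψ` ("a `p`-bit float is a `p'`-bit float for `p' ≥ p`, exponent range
  permitting") [IEEE7542019, §3.3 and §5.4.2: conversion to a wider format of the same radix is
  exact]. Consequently WIDENING CONVERSIONS ARE EXACT (`toRat_roundNE_eq_of_le`) and the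
  widen-then-narrow round trip is the identity on values (`toRat_roundNE_roundNE_eq_of_le`).
* INSTANCES for the named formats: all of `E2M1`, `E3M2`, `E2M3`, `E4M3`, `E5M2` embed in
  `binary16`, `bfloat16`, `binary32`; `E2M1 ⊆ E3M2, E2M3, E4M3, E5M2`; `E3M2 ⊆ E4M3, E5M2`;
  `E2M3 ⊆ E4M3` (parameter inequalities by `decide`). NON-INSTANCES with explicit witnesses:
  `E3M2 ⊄ E2M3` (`28`), `E2M3 ⊄ E3M2` (`15/8`), `E2M3 ⊄ E5M2` (`15/8`), `E4M3 ⊄ E5M2` (`15/8`),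
  `E5M2 ⊄ E4M3` (`57344`), `binary16 ⊄ bfloat16` (`1 + 2^-10`), `bfloat16 ⊄ binary16` (`2^120`).
* COMMUTATIVITY ACROSS FORMATS (`fadd_comm`, `fmul_comm`): the datum-level operations of
  `ErrorTables.lean` with heterogeneous operand formats deliver the same DATUM (value and sign of
  zero) in either operand order — the theorem behind the cell's cross-format commutativity
  certificate (enumerated there for the FP6/FP4 pairs; here for every pair of formats).

Deliberately NOT here: narrowing-conversion envelopes (they are `abs_sub_roundNE_le_max` /
`abs_sub_roundNE_le_half_ulp_result` at `x.toRat`, nothing new), double rounding through an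
intermediate format (file `DoubleRounding.lean`).
-/

namespace Literature.ComputerArithmetic.FloatingPoint

namespace MiniFloat

open Format
open Literature.ComputerArithmetic.JeannerodRump2018

variable {φ ψ : Format}

/-! ### The embedding criterion -/

/-- EMBEDDING OF VALUE SETS: if `m_φ ≤ m_ψ`, `qexp ψ ≤ qexp φ` and `maxRat φ ≤ maxRat ψ` then every
finite value of `φ` is (the value of) a finite datum of `ψ`. [cite: IEEE7542019, §5.4.2] -/
theorem exists_toRat_eq_of_le (hm : φ.manBits ≤ ψ.manBits) (hq : ψ.qexp ≤ φ.qexp)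
    (hmax : φ.maxRat ≤ ψ.maxRat) (x : MiniFloat φ) : ∃ z : MiniFloat ψ, z.toRat = x.toRat := by
  obtain ⟨M, e, hM, he, hx⟩ := isFloat_toRat x
  refine exists_toRat_eq_of_isFloat ⟨M, e, lt_of_lt_of_le hM ?_, le_trans hq he, hx⟩
    (le_trans (abs_toRat_le_maxRat x) hmax)
  exact_mod_cast Nat.pow_le_pow_right (by norm_num) (by omega)

/-- WIDENING CONVERSION IS EXACT: under the embedding criterion, `roundNE ψ` returns the value of
every datum of `φ` unchanged. [cite: IEEE7542019, §5.4.2] -/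
theorem toRat_roundNE_eq_of_le (hm : φ.manBits ≤ ψ.manBits) (hq : ψ.qexp ≤ φ.qexp)
    (hmax : φ.maxRat ≤ ψ.maxRat) (x : MiniFloat φ) : (roundNE ψ x.toRat).toRat = x.toRat :=
  toRat_roundNE_of_exists (exists_toRat_eq_of_le hm hq hmax x)

/-- ROUND TRIP: widening to `ψ` and converting back to `φ` is the identity on values.
[cite: IEEE7542019, §5.4.2] -/
theorem toRat_roundNE_roundNE_eq_of_le (hm : φ.manBits ≤ ψ.manBits) (hq : ψ.qexp ≤ φ.qexp)
    (hmax : φ.maxRat ≤ ψ.maxRat) (x : MiniFloat φ) :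
    (roundNE φ (roundNE ψ x.toRat).toRat).toRat = x.toRat := by
  rw [toRat_roundNE_eq_of_le hm hq hmax x, toRat_roundNE_toRat]

/-- Under the embedding criterion a conversion INTO `φ` of any rational, re-read in `ψ`, is exact:
`roundNE ψ (roundNE φ t) = roundNE φ t` as values (narrow results are wide values). [folklore] -/
theorem toRat_roundNE_toRat_roundNE_of_le (hm : φ.manBits ≤ ψ.manBits) (hq : ψ.qexp ≤ φ.qexp)
    (hmax : φ.maxRat ≤ ψ.maxRat) (t : ℚ) :
    (roundNE ψ (roundNE φ t).toRat).toRat = (roundNE φ t).toRat :=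
  toRat_roundNE_eq_of_le hm hq hmax _

/-! ### Commutativity of the datum-level operations across formats -/

/-- CROSS-FORMAT COMMUTATIVITY OF ADDITION: for operands of any two formats and any destination
format, `fadd ψ a b = fadd ψ b a` as DATA (same value, same sign of an exact-zero result).
[cite: IEEE7542019, §6.3] -/
theorem fadd_comm {φ₁ φ₂ : Format} (ψ : Format) (a : MiniFloat φ₁) (b : MiniFloat φ₂) :
    fadd ψ a b = fadd ψ b a := by
  unfold fadd
  rw [add_comm b.toRat, Bool.and_comm]

/-- CROSS-FORMAT COMMUTATIVITY OF MULTIPLICATION: `fmul ψ a b = fmul ψ b a` as data (the sign of a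
zero product is the XOR of the operand signs, symmetric). [cite: IEEE7542019, §6.3] -/
theorem fmul_comm {φ₁ φ₂ : Format} (ψ : Format) (a : MiniFloat φ₁) (b : MiniFloat φ₂) :
    fmul ψ a b = fmul ψ b a := by
  unfold fmul
  have h : (a.neg != b.neg) = (b.neg != a.neg) := by cases a.neg <;> cases b.neg <;> rfl
  rw [mul_comm b.toRat, h]

/-- The signed errors are symmetric as well: `fl(a+b) - (a+b)` is invariant under swapping the
operands (heterogeneous formats, any destination). [folklore] -/
theorem toRat_fadd_comm {φ₁ φ₂ : Format} (ψ : Format) (a : MiniFloat φ₁) (b : MiniFloat φ₂) :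
    (fadd ψ a b).toRat - (a.toRat + b.toRat) = (fadd ψ b a).toRat - (b.toRat + a.toRat) := by
  rw [fadd_comm, add_comm]

end MiniFloat

/-! ### Instances: the embedding lattice of the named formats -/

namespace Format

open MiniFloat

/-- `E2M1 ⊆ E3M2`. [cite: RouhaniEtAl2023MX, Table 1] -/
theorem E2M1_sub_E3M2 (x : MiniFloat E2M1) : ∃ z : MiniFloat E3M2, z.toRat = x.toRat :=
  exists_toRat_eq_of_le (by decide) (by decide) (by decide +kernel) x

/-- `E2M1 ⊆ E2M3`. [cite: RouhaniEtAl2023MX, Table 1] -/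
theorem E2M1_sub_E2M3 (x : MiniFloat E2M1) : ∃ z : MiniFloat E2M3, z.toRat = x.toRat :=
  exists_toRat_eq_of_le (by decide) (by decide) (by decide +kernel) x

/-- `E2M1 ⊆ E4M3`. [cite: MicikeviciusEtAl2022, Table 1] -/
theorem E2M1_sub_E4M3 (x : MiniFloat E2M1) : ∃ z : MiniFloat E4M3, z.toRat = x.toRat :=
  exists_toRat_eq_of_le (by decide) (by decide) (by decide +kernel) x

/-- `E2M1 ⊆ E5M2`. [cite: MicikeviciusEtAl2022, Table 1] -/
theorem E2M1_sub_E5M2 (x : MiniFloat E2M1) : ∃ z : MiniFloat E5M2, z.toRat = x.toRat :=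
  exists_toRat_eq_of_le (by decide) (by decide) (by decide +kernel) x

/-- `E3M2 ⊆ E4M3`. [cite: MicikeviciusEtAl2022, Table 1] -/
theorem E3M2_sub_E4M3 (x : MiniFloat E3M2) : ∃ z : MiniFloat E4M3, z.toRat = x.toRat :=
  exists_toRat_eq_of_le (by decide) (by decide) (by decide +kernel) x

/-- `E3M2 ⊆ E5M2`. [cite: MicikeviciusEtAl2022, Table 1] -/
theorem E3M2_sub_E5M2 (x : MiniFloat E3M2) : ∃ z : MiniFloat E5M2, z.toRat = x.toRat :=
  exists_toRat_eq_of_le (by decide) (by decide) (by decide +kernel) x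

/-- `E2M3 ⊆ E4M3`. [cite: MicikeviciusEtAl2022, Table 1] -/
theorem E2M3_sub_E4M3 (x : MiniFloat E2M3) : ∃ z : MiniFloat E4M3, z.toRat = x.toRat :=
  exists_toRat_eq_of_le (by decide) (by decide) (by decide +kernel) x

/-- `E2M1 ⊆ binary16`. [cite: IEEE7542019, §3.6] -/
theorem E2M1_sub_Binary16 (x : MiniFloat E2M1) : ∃ z : MiniFloat Binary16, z.toRat = x.toRat :=
  exists_toRat_eq_of_le (by decide) (by decide) (by decide +kernel) x

/-- `E3M2 ⊆ binary16`. [cite: IEEE7542019, §3.6] -/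
theorem E3M2_sub_Binary16 (x : MiniFloat E3M2) : ∃ z : MiniFloat Binary16, z.toRat = x.toRat :=
  exists_toRat_eq_of_le (by decide) (by decide) (by decide +kernel) x

/-- `E2M3 ⊆ binary16`. [cite: IEEE7542019, §3.6] -/
theorem E2M3_sub_Binary16 (x : MiniFloat E2M3) : ∃ z : MiniFloat Binary16, z.toRat = x.toRat :=
  exists_toRat_eq_of_le (by decide) (by decide) (by decide +kernel) x

/-- `E4M3 ⊆ binary16`. [cite: IEEE7542019, §3.6] -/
theorem E4M3_sub_Binary16 (x : MiniFloat E4M3) : ∃ z : MiniFloat Binary16, z.toRat = x.toRat :=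
  exists_toRat_eq_of_le (by decide) (by decide) (by decide +kernel) x

/-- `E5M2 ⊆ binary16` (E5M2 is binary16 with the trailing significand cut to 2 bits).
[cite: MicikeviciusEtAl2022, §3] -/
theorem E5M2_sub_Binary16 (x : MiniFloat E5M2) : ∃ z : MiniFloat Binary16, z.toRat = x.toRat :=
  exists_toRat_eq_of_le (by decide) (by decide) (by decide +kernel) x

/-- `E2M1 ⊆ bfloat16`. [cite: BlanchardHighamLopezMaryPranesh2020, §2] -/
theorem E2M1_sub_BFloat16 (x : MiniFloat E2M1) : ∃ z : MiniFloat BFloat16, z.toRat = x.toRat :=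
  exists_toRat_eq_of_le (by decide) (by decide) (by decide +kernel) x

/-- `E3M2 ⊆ bfloat16`. [cite: BlanchardHighamLopezMaryPranesh2020, §2] -/
theorem E3M2_sub_BFloat16 (x : MiniFloat E3M2) : ∃ z : MiniFloat BFloat16, z.toRat = x.toRat :=
  exists_toRat_eq_of_le (by decide) (by decide) (by decide +kernel) x

/-- `E2M3 ⊆ bfloat16`. [cite: BlanchardHighamLopezMaryPranesh2020, §2] -/
theorem E2M3_sub_BFloat16 (x : MiniFloat E2M3) : ∃ z : MiniFloat BFloat16, z.toRat = x.toRat :=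
  exists_toRat_eq_of_le (by decide) (by decide) (by decide +kernel) x

/-- `E4M3 ⊆ bfloat16`. [cite: BlanchardHighamLopezMaryPranesh2020, §2] -/
theorem E4M3_sub_BFloat16 (x : MiniFloat E4M3) : ∃ z : MiniFloat BFloat16, z.toRat = x.toRat :=
  exists_toRat_eq_of_le (by decide) (by decide) (by decide +kernel) x

/-- `E5M2 ⊆ bfloat16`. [cite: BlanchardHighamLopezMaryPranesh2020, §2] -/
theorem E5M2_sub_BFloat16 (x : MiniFloat E5M2) : ∃ z : MiniFloat BFloat16, z.toRat = x.toRat :=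
  exists_toRat_eq_of_le (by decide) (by decide) (by decide +kernel) x

/-- `E2M1 ⊆ binary32`. [cite: IEEE7542019, §3.6] -/
theorem E2M1_sub_Binary32 (x : MiniFloat E2M1) : ∃ z : MiniFloat Binary32, z.toRat = x.toRat :=
  exists_toRat_eq_of_le (by decide) (by decide) (by decide +kernel) x

/-- `E3M2 ⊆ binary32`. [cite: IEEE7542019, §3.6] -/
theorem E3M2_sub_Binary32 (x : MiniFloat E3M2) : ∃ z : MiniFloat Binary32, z.toRat = x.toRat :=
  exists_toRat_eq_of_le (by decide) (by decide) (by decide +kernel) x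

/-- `E2M3 ⊆ binary32`. [cite: IEEE7542019, §3.6] -/
theorem E2M3_sub_Binary32 (x : MiniFloat E2M3) : ∃ z : MiniFloat Binary32, z.toRat = x.toRat :=
  exists_toRat_eq_of_le (by decide) (by decide) (by decide +kernel) x

/-- `E4M3 ⊆ binary32`. [cite: IEEE7542019, §3.6] -/
theorem E4M3_sub_Binary32 (x : MiniFloat E4M3) : ∃ z : MiniFloat Binary32, z.toRat = x.toRat :=
  exists_toRat_eq_of_le (by decide) (by decide) (by decide +kernel) x

/-- `E5M2 ⊆ binary32`. [cite: IEEE7542019, §3.6] -/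
theorem E5M2_sub_Binary32 (x : MiniFloat E5M2) : ∃ z : MiniFloat Binary32, z.toRat = x.toRat :=
  exists_toRat_eq_of_le (by decide) (by decide) (by decide +kernel) x

/-! ### Non-instances (explicit witnesses) -/

/-- `E3M2 ⊄ E2M3`: `28 ∈ E3M2` exceeds `maxRat E2M3 = 15/2`. [folklore] -/
theorem E3M2_not_sub_E2M3 : ¬ ∀ x : MiniFloat E3M2, ∃ z : MiniFloat E2M3, z.toRat = x.toRat := by
  intro h
  obtain ⟨z, hz⟩ := h (top E3M2)
  have h1 := abs_toRat_le_maxRat z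
  rw [hz, E2M3_maxRat.1, show (top E3M2).toRat = 28 by decide +kernel] at h1
  norm_num at h1

/-- `E2M3 ⊄ E3M2`: `15/8 ∈ E2M3` needs four significand bits. [folklore] -/
theorem E2M3_not_sub_E3M2 : ¬ ∀ x : MiniFloat E2M3, ∃ z : MiniFloat E3M2, z.toRat = x.toRat := by
  intro h
  obtain ⟨z, hz⟩ := h ⟨false, 1, 7, by decide, by decide, by decide⟩
  have h1 : (⟨false, 1, 7, by decide, by decide, by decide⟩ : MiniFloat E2M3).toRat = 15 / 8 := by
    decide +kernel
  rw [h1] at hz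
  have hno : ¬ ∃ z : MiniFloat E3M2, z.toRat = 15 / 8 := by decide +kernel
  exact hno ⟨z, hz⟩

/-- `E2M3 ⊄ E5M2`: `15/8` again (E5M2 has three significand bits). [folklore] -/
theorem E2M3_not_sub_E5M2 : ¬ ∀ x : MiniFloat E2M3, ∃ z : MiniFloat E5M2, z.toRat = x.toRat := by
  intro h
  obtain ⟨z, hz⟩ := h ⟨false, 1, 7, by decide, by decide, by decide⟩
  have h1 : (⟨false, 1, 7, by decide, by decide, by decide⟩ : MiniFloat E2M3).toRat = 15 / 8 := by
    decide +kernel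
  rw [h1] at hz
  have hno : ¬ ∃ z : MiniFloat E5M2, z.toRat = 15 / 8 := by decide +kernel
  exact hno ⟨z, hz⟩

/-- `E4M3 ⊄ E5M2`: `15/8 ∈ E4M3` needs four significand bits. [folklore] -/
theorem E4M3_not_sub_E5M2 : ¬ ∀ x : MiniFloat E4M3, ∃ z : MiniFloat E5M2, z.toRat = x.toRat := by
  intro h
  obtain ⟨z, hz⟩ := h ⟨false, 7, 7, by decide, by decide, by decide⟩
  have h1 : (⟨false, 7, 7, by decide, by decide, by decide⟩ : MiniFloat E4M3).toRat = 15 / 8 := by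
    decide +kernel
  rw [h1] at hz
  have hno : ¬ ∃ z : MiniFloat E5M2, z.toRat = 15 / 8 := by decide +kernel
  exact hno ⟨z, hz⟩

/-- `E5M2 ⊄ E4M3`: `57344 ∈ E5M2` exceeds `maxRat E4M3 = 448`. [folklore] -/
theorem E5M2_not_sub_E4M3 : ¬ ∀ x : MiniFloat E5M2, ∃ z : MiniFloat E4M3, z.toRat = x.toRat := by
  intro h
  obtain ⟨z, hz⟩ := h (top E5M2)
  have h1 := abs_toRat_le_maxRat z
  rw [hz, E4M3_maxRat.1, show (top E5M2).toRat = 57344 by decide +kernel] at h1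
  norm_num at h1

/-- `bfloat16 ⊄ binary16`: `2^120 · (2^8 - 1) ∈ bfloat16` exceeds `65504`. [folklore] -/
theorem BFloat16_not_sub_Binary16 :
    ¬ ∀ x : MiniFloat BFloat16, ∃ z : MiniFloat Binary16, z.toRat = x.toRat := by
  intro h
  obtain ⟨z, hz⟩ := h (top BFloat16)
  have h1 := abs_toRat_le_maxRat z
  have h2 : (top BFloat16).toRat = BFloat16.maxRat := by
    rw [← abs_of_nonneg (show (0:ℚ) ≤ (top BFloat16).toRat by decide +kernel), abs_toRat,
      scaledMag_top]; rfl
  rw [hz, h2, Binary16_maxRat.1, BFloat16_maxRat.1] at h1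
  norm_num at h1

/-- `binary16 ⊄ bfloat16`: `1 + 2^-10 ∈ binary16` needs eleven significand bits; a bfloat16 value
in `[1, 2)` is a multiple of `2^-7`. [folklore] -/
theorem Binary16_not_sub_BFloat16 :
    ¬ ∀ x : MiniFloat Binary16, ∃ z : MiniFloat BFloat16, z.toRat = x.toRat := by
  intro h
  obtain ⟨z, hz⟩ := h ⟨false, 15, 1, by decide, by decide, by decide⟩
  have h1 : (⟨false, 15, 1, by decide, by decide, by decide⟩ : MiniFloat Binary16).toRat
      = 1025 / 1024 := by
    rw [toRat, toInt, Binary16_maxRat.2]; norm_num [scaledMag, Format.scaled, Binary16]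
  rw [h1] at hz
  -- a bfloat16 value is `M · 2^e` with `|M| < 2^8`, `e ≥ -133`; `1025/1024` would need `M` odd
  -- with `M · 2^(e+10) = 1025`, i.e. `M = 1025 > 255`.
  obtain ⟨M, e, hM, -, hv⟩ := isFloat_toRat z
  rw [hz] at hv
  have h2 : (2:ℚ) ≠ 0 := by norm_num
  -- 1025 = M · 2^(e+10)
  have h3 : (1025 : ℚ) = (M : ℚ) * 2 ^ (e + 10) := by
    rw [zpow_add₀ h2, ← mul_assoc, ← hv]; norm_num
  rcases le_or_gt 0 (e + 10) with he | he
  · obtain ⟨k, hk⟩ := Int.eq_ofNat_of_zero_le he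
    rw [hk, zpow_natCast] at h3
    have h4 : (1025 : ℤ) = M * 2 ^ k := by exact_mod_cast h3
    have hMle : |M| ≤ 255 := by
      have : (2:ℤ) ^ (7 + 1) = 256 := by norm_num
      simp only [BFloat16] at hM; omega
    have hk0 : k = 0 := by
      rcases Nat.eq_zero_or_pos k with hk0 | hk0
      · exact hk0
      · exfalso
        have : (2 : ℤ) ∣ 1025 := by
          rw [h4]; exact Dvd.dvd.mul_left (dvd_pow_self 2 (by omega)) M
        omega
    rw [hk0, pow_zero, mul_one] at h4
    have := abs_le.mp hMle
    omega
  · -- negative exponent: 1025 · 2^(-(e+10)) = M is an integer multiple of 2, impossible (1025 odd)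
    obtain ⟨k, hk⟩ := Int.eq_ofNat_of_zero_le (by omega : 0 ≤ -(e + 10))
    have h4 : (M : ℚ) = 1025 * 2 ^ k := by
      have : (2 : ℚ) ^ (e + 10) = ((2 : ℚ) ^ k)⁻¹ := by
        rw [← zpow_natCast, ← zpow_neg, ← hk, neg_neg]
      rw [this] at h3
      field_simp at h3
      linarith
    have h5 : M = 1025 * 2 ^ k := by exact_mod_cast h4
    have hk1 : 1 ≤ k := by omega
    have hMle : |M| < 2 ^ (7 + 1) := by simpa [BFloat16] using hM
    have : (2 : ℤ) ^ k ≥ 2 := by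
      calc (2:ℤ) ^ k ≥ 2 ^ 1 := pow_le_pow_right₀ (by norm_num) hk1
        _ = 2 := by norm_num
    have h6 : |M| ≥ 2050 := by rw [h5, abs_of_nonneg (by positivity)]; nlinarith
    norm_num at hMle
    omega

end Format

end Literature.ComputerArithmetic.FloatingPoint
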